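import Mathlib.LinearAlgebra.FiniteDimensional.Lemmas
import Mathlib.LinearAlgebra.Dimension.Constructions
import Mathlib.Data.Fin.Tuple.Basic
import HarnessLib

/-!
# Rank by Gaussian elimination: a column sweep whose pivot count is the dimension of the row span

Toolkit (linear algebra behind the CONSTRUCTIVITY of rank-based natural properties, first client:
the Razborov–Smolensky property `rsProperty` of `MetaComplexity/SmolenskyNaturalProperty.lean`,
whose test is "`dim_{𝔽_p}` of the span of `2ⁿ` explicit vectors `≥ (3/4)2ⁿ`"). A machine deciding
such a property runs an elimination; to certify it we need an elimination procedure written as a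
plain function together with a PROOF that the number it returns is `finrank (span rows)`. Mathlib
has ranks and transvections but no verified elimination algorithm returning the rank; this file
supplies the simplest one that a string machine can mirror literally (no division, no row swaps):

* `State` — the rows `Fin M → Fin N → F` and a flag `piv : Fin M → Bool` ("already a pivot row");
* `pick st j` — the first non-pivot row with a nonzero entry in column `j` (`Fin.find`);
  `elim st j i₀` — every other row `r` becomes `c·r − r_j·r_{i₀}` with `c = (r_{i₀})_j ≠ 0`
  (fraction-free elimination of column `j`), and `i₀` is flagged; `step` = `pick` then `elim`;
* `runTo A t` — the state after sweeping columns `0, …, t-1`; `rank A` — the number of flagged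
  rows after all `N` columns;
* the invariant `Inv` (row span unchanged; each pivot row owns a swept column in which it is the
  only nonzero row; swept columns vanish on non-pivot rows), `inv_runTo`;
* **`rank_eq_finrank_span`**: `rank A = finrank F (span F (range A))` — at the end the non-pivot
  rows are zero and the pivot rows are linearly independent (`linearIndependent_pivots`).

Everything is over an arbitrary field with decidable equality; all statements are proved.

## References

* S. Lang, *Algebra*, 3rd ed., Springer GTM 211 (2002), §XIII.3–4 (row rank, elimination by
  elementary row operations preserves the row space). [folklore]
* J. von zur Gathen, J. Gerhard, *Modern Computer Algebra*, 3rd ed., CUP 2013, §12.1 (Gaussian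
  elimination; fraction-free variants). (Schoolbook; proved here.)
-/

namespace Literature.Computability.Complexity

namespace GaussRank

open Finset Module

variable {F : Type*} [Field F] [DecidableEq F] {M N : ℕ}

/-! ### The sweep -/

/-- The state of the sweep: the current rows and the pivot flags. [folklore] -/
structure State (F : Type*) (M N : ℕ) where
  /-- the current rows -/
  rows : Fin M → Fin N → F
  /-- `piv i = true` iff row `i` has already been chosen as a pivot row -/
  piv : Fin M → Bool

/-- The pivot choice for column `j`: the FIRST row not yet a pivot with a nonzero entry in
column `j`. [folklore] -/
def pick (st : State F M N) (j : Fin N) : Option (Fin M) :=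
  if h : ∃ i, st.piv i = false ∧ st.rows i j ≠ 0 then
    some (Fin.find (fun i => st.piv i = false ∧ st.rows i j ≠ 0) h)
  else none

/-- Fraction-free elimination of column `j` by the pivot row `i₀`: every other row `r` becomes
`c·r − r_j·r_{i₀}` with `c = (r_{i₀})_j`; row `i₀` is kept and flagged. [folklore] -/
def elim (st : State F M N) (j : Fin N) (i₀ : Fin M) : State F M N where
  rows i := if i = i₀ then st.rows i₀
    else fun k => st.rows i₀ j * st.rows i k - st.rows i j * st.rows i₀ k
  piv i := if i = i₀ then true else st.piv i

/-- One column of the sweep. [folklore] -/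
def step (st : State F M N) (j : Fin N) : State F M N :=
  match pick st j with
  | none => st
  | some i₀ => elim st j i₀

/-- The initial state: the given rows, no pivots. [folklore] -/
def init (A : Fin M → Fin N → F) : State F M N := ⟨A, fun _ => false⟩

/-- The state after sweeping the columns `0, …, t-1` (columns `≥ N` do nothing). [folklore] -/
def runTo (A : Fin M → Fin N → F) : ℕ → State F M N
  | 0 => init A
  | t + 1 => if h : t < N then step (runTo A t) ⟨t, h⟩ else runTo A t

/-- **The rank**: the number of pivot rows after the full sweep. [folklore] -/
def rank (A : Fin M → Fin N → F) : ℕ :=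
  (univ.filter fun i => (runTo A N).piv i = true).card

/-! ### Unfolding lemmas -/

omit [DecidableEq F] in
/-- Rows of `elim`. [folklore] -/
theorem elim_rows_self (st : State F M N) (j : Fin N) (i₀ : Fin M) :
    (elim st j i₀).rows i₀ = st.rows i₀ := by
  simp [elim]

omit [DecidableEq F] in
/-- Rows of `elim`, other rows. [folklore] -/
theorem elim_rows_ne (st : State F M N) (j : Fin N) {i₀ i : Fin M} (h : i ≠ i₀) (k : Fin N) :
    (elim st j i₀).rows i k = st.rows i₀ j * st.rows i k - st.rows i j * st.rows i₀ k := by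
  simp [elim, h]

omit [DecidableEq F] in
/-- Flags of `elim`. [folklore] -/
theorem elim_piv (st : State F M N) (j : Fin N) (i₀ i : Fin M) :
    (elim st j i₀).piv i = if i = i₀ then true else st.piv i := rfl

/-- What `pick` guarantees. [folklore] -/
theorem pick_spec {st : State F M N} {j : Fin N} {i₀ : Fin M} (h : pick st j = some i₀) :
    st.piv i₀ = false ∧ st.rows i₀ j ≠ 0 := by
  unfold pick at h
  split_ifs at h with hex
  rw [Option.some.injEq] at h
  rw [← h]
  exact Fin.find_spec hex

/-- `pick` returns the LEAST admissible row. [folklore] -/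
theorem pick_min {st : State F M N} {j : Fin N} {i₀ : Fin M} (h : pick st j = some i₀)
    {i : Fin M} (hi : i < i₀) : ¬(st.piv i = false ∧ st.rows i j ≠ 0) := by
  unfold pick at h
  split_ifs at h with hex
  rw [Option.some.injEq] at h
  rw [← h] at hi
  exact Fin.find_min hex hi

/-- When `pick` finds nothing, column `j` vanishes on the non-pivot rows. [folklore] -/
theorem pick_none {st : State F M N} {j : Fin N} (h : pick st j = none) :
    ∀ i, st.piv i = false → st.rows i j = 0 := by
  intro i hi
  by_contra hne
  unfold pick at h
  split_ifs at h with hex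
  exact hex ⟨i, hi, hne⟩

/-- `pick` succeeds as soon as some non-pivot row is nonzero in column `j`. [folklore] -/
theorem pick_ne_none {st : State F M N} {j : Fin N} {i : Fin M} (hi : st.piv i = false)
    (hne : st.rows i j ≠ 0) : pick st j ≠ none := by
  unfold pick
  rw [dif_pos ⟨i, hi, hne⟩]
  exact Option.some_ne_none _

/-! ### The invariant -/

/-- **The sweep invariant after `t` columns**: (a) the row span is that of `A`; (b) every pivot
row `i` owns a swept column `j < t` where it is nonzero and every other row vanishes; (c) every
swept column vanishes on every non-pivot row. [folklore] -/
structure Inv (A : Fin M → Fin N → F) (t : ℕ) (st : State F M N) : Prop where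
  /-- the row span is unchanged -/
  span_eq : Submodule.span F (Set.range st.rows) = Submodule.span F (Set.range A)
  /-- every pivot row owns a swept column -/
  owns : ∀ i, st.piv i = true → ∃ j : Fin N, (j : ℕ) < t ∧ st.rows i j ≠ 0 ∧
    ∀ i', i' ≠ i → st.rows i' j = 0
  /-- swept columns vanish on non-pivot rows -/
  swept : ∀ j : Fin N, (j : ℕ) < t → ∀ i, st.piv i = false → st.rows i j = 0

omit [DecidableEq F] in
/-- The invariant holds initially. [folklore] -/
theorem inv_init (A : Fin M → Fin N → F) : Inv A 0 (init A) :=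
  ⟨rfl, fun i hi => by simp [init] at hi, fun j hj => by omega⟩

omit [DecidableEq F] in
/-- The invariant is monotone in `t` when no new column is swept beyond `N`. [folklore] -/
theorem Inv.mono {A : Fin M → Fin N → F} {t t' : ℕ} {st : State F M N} (h : Inv A t st)
    (htt' : t ≤ t') (hN : ∀ j : Fin N, (j : ℕ) < t' → (j : ℕ) < t) : Inv A t' st :=
  ⟨h.span_eq, fun i hi => by
    obtain ⟨j, hj, h1, h2⟩ := h.owns i hi
    exact ⟨j, lt_of_lt_of_le hj htt', h1, h2⟩,
   fun j hj => h.swept j (hN j hj)⟩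

omit [DecidableEq F] in
/-- **Elimination preserves the row span** (the pivot entry `c ≠ 0` is invertible).
[folklore] -/
theorem span_elim (st : State F M N) (j : Fin N) (i₀ : Fin M) (hc : st.rows i₀ j ≠ 0) :
    Submodule.span F (Set.range (elim st j i₀).rows) = Submodule.span F (Set.range st.rows) := by
  apply le_antisymm
  · rw [Submodule.span_le]
    rintro _ ⟨i, rfl⟩
    by_cases hi : i = i₀
    · subst hi
      rw [elim_rows_self]
      exact Submodule.subset_span ⟨i, rfl⟩
    · have hrw : (elim st j i₀).rows i = st.rows i₀ j • st.rows i - st.rows i j • st.rows i₀ := by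
        funext k
        rw [elim_rows_ne st j hi k]
        simp [smul_eq_mul]
      rw [SetLike.mem_coe, hrw]
      exact Submodule.sub_mem _ (Submodule.smul_mem _ _ (Submodule.subset_span ⟨i, rfl⟩))
        (Submodule.smul_mem _ _ (Submodule.subset_span ⟨i₀, rfl⟩))
  · rw [Submodule.span_le]
    rintro _ ⟨i, rfl⟩
    have h0 : st.rows i₀ ∈ Submodule.span F (Set.range (elim st j i₀).rows) := by
      rw [← elim_rows_self st j i₀]
      exact Submodule.subset_span ⟨i₀, rfl⟩
    by_cases hi : i = i₀
    · subst hi; exact h0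
    · -- `r_i = c⁻¹ (new r_i + a r_{i₀})`
      have hrw : st.rows i = (st.rows i₀ j)⁻¹ • ((elim st j i₀).rows i + st.rows i j • st.rows i₀) := by
        funext k
        simp only [Pi.smul_apply, Pi.add_apply, smul_eq_mul, elim_rows_ne st j hi k]
        field_simp
        ring
      rw [SetLike.mem_coe, hrw]
      exact Submodule.smul_mem _ _ (Submodule.add_mem _ (Submodule.subset_span ⟨i, rfl⟩)
        (Submodule.smul_mem _ _ h0))

/-- **One column preserves the invariant.** [folklore] -/
theorem inv_step {A : Fin M → Fin N → F} {t : ℕ} (ht : t < N) {st : State F M N}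
    (h : Inv A t st) : Inv A (t + 1) (step st ⟨t, ht⟩) := by
  set jt : Fin N := ⟨t, ht⟩ with hjt
  unfold step
  cases hp : pick st jt with
  | none =>
    -- no pivot: column `t` already vanishes on the non-pivot rows
    refine ⟨h.span_eq, fun i hi => ?_, fun j hj i hi => ?_⟩
    · obtain ⟨j, hj, h1, h2⟩ := h.owns i hi
      exact ⟨j, by omega, h1, h2⟩
    · rcases Nat.lt_succ_iff_lt_or_eq.1 hj with hj' | hj'
      · exact h.swept j hj' i hi
      · have : j = jt := Fin.ext hj'
        rw [this]
        exact pick_none hp i hi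
  | some i₀ =>
    obtain ⟨hpiv0, hc⟩ := pick_spec hp
    refine ⟨(span_elim st jt i₀ hc).trans h.span_eq, fun i hi => ?_, fun j hj i hi => ?_⟩
    · -- (b) ownership
      by_cases hi0 : i = i₀
      · subst hi0
        refine ⟨jt, by simp [hjt], by rwa [elim_rows_self], fun i' hi' => ?_⟩
        rw [elim_rows_ne st jt hi']
        ring
      · have hpi : st.piv i = true := by simpa [elim_piv, hi0] using hi
        obtain ⟨j, hj, h1, h2⟩ := h.owns i hpi
        have h0j : st.rows i₀ j = 0 := h2 i₀ (Ne.symm hi0)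
        refine ⟨j, by omega, ?_, fun i' hi' => ?_⟩
        · rw [elim_rows_ne st jt hi0, h0j, mul_zero, sub_zero]
          exact mul_ne_zero hc h1
        · by_cases hi'0 : i' = i₀
          · subst hi'0; rwa [elim_rows_self]
          · rw [elim_rows_ne st jt hi'0, h2 i' hi', h0j]; ring
    · -- (c) swept columns
      have hi0 : i ≠ i₀ := by
        rintro rfl
        simp [elim_piv] at hi
      have hpi : st.piv i = false := by simpa [elim_piv, hi0] using hi
      rw [elim_rows_ne st jt hi0]
      rcases Nat.lt_succ_iff_lt_or_eq.1 hj with hj' | hj'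
      · rw [h.swept j hj' i hpi, h.swept j hj' i₀ hpiv0]; ring
      · have : j = jt := Fin.ext hj'
        rw [this]; ring

/-- **The invariant along the sweep.** [folklore] -/
theorem inv_runTo (A : Fin M → Fin N → F) : ∀ t, Inv A t (runTo A t)
  | 0 => inv_init A
  | t + 1 => by
    unfold runTo
    split_ifs with h
    · exact inv_step h (inv_runTo A t)
    · exact (inv_runTo A t).mono (Nat.le_succ t) fun j hj => lt_of_lt_of_le j.isLt (not_lt.1 h)

/-! ### The rank is the dimension of the row span -/

omit [DecidableEq F] in
/-- After the full sweep the non-pivot rows are zero. [folklore] -/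
theorem rows_eq_zero_of_piv_false {A : Fin M → Fin N → F} {st : State F M N} (h : Inv A N st)
    {i : Fin M} (hi : st.piv i = false) : st.rows i = 0 :=
  funext fun j => h.swept j j.isLt i hi

omit [DecidableEq F] in
/-- **The pivot rows are linearly independent** (each owns a column where it alone is nonzero).
[folklore] -/
theorem linearIndependent_pivots {A : Fin M → Fin N → F} {t : ℕ} {st : State F M N}
    (h : Inv A t st) :
    LinearIndependent F (fun i : {i // st.piv i = true} => st.rows i.1) := by
  rw [linearIndependent_iff']
  intro s g hsum i hi
  obtain ⟨j, -, h1, h2⟩ := h.owns i.1 i.2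
  have heval := congrFun hsum j
  rw [Finset.sum_apply, Pi.zero_apply, Finset.sum_eq_single i] at heval
  · rw [Pi.smul_apply, smul_eq_mul] at heval
    exact (mul_eq_zero.1 heval).resolve_right h1
  · intro i' _ hi'
    rw [Pi.smul_apply, smul_eq_mul, h2 i'.1 (fun he => hi' (Subtype.ext he)), mul_zero]
  · intro hni
    exact absurd hi hni

omit [DecidableEq F] in
/-- After the full sweep the row span is spanned by the pivot rows. [folklore] -/
theorem span_range_eq_span_pivots {A : Fin M → Fin N → F} {st : State F M N} (h : Inv A N st) :
    Submodule.span F (Set.range st.rows) =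
      Submodule.span F (Set.range fun i : {i // st.piv i = true} => st.rows i.1) := by
  apply le_antisymm
  · rw [Submodule.span_le]
    rintro _ ⟨i, rfl⟩
    by_cases hi : st.piv i = true
    · exact Submodule.subset_span ⟨⟨i, hi⟩, rfl⟩
    · have hi' : st.piv i = false := by simpa using hi
      rw [SetLike.mem_coe, rows_eq_zero_of_piv_false h hi']
      exact Submodule.zero_mem _
  · rw [Submodule.span_le]
    rintro _ ⟨i, rfl⟩
    exact Submodule.subset_span ⟨i.1, rfl⟩

/-- **The pivot count of the sweep is the dimension of the row span.** [folklore] -/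
theorem rank_eq_finrank_span (A : Fin M → Fin N → F) :
    rank A = Module.finrank F (Submodule.span F (Set.range A)) := by
  classical
  have hInv := inv_runTo A N
  set st := runTo A N with hst
  rw [← hInv.span_eq, span_range_eq_span_pivots hInv,
    finrank_span_eq_card (linearIndependent_pivots hInv), Fintype.card_subtype]
  rfl

/-- The rank is at most the number of rows. [folklore] -/
theorem rank_le (A : Fin M → Fin N → F) : rank A ≤ M :=
  (Finset.card_filter_le _ _).trans (by simp)

end GaussRank

end Literature.Computability.Complexity
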